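import Literature.AlgebraicGeometry.Milne1999.SpecialLefschetzGroupInvariantsPowers
import Literature.AlgebraicGeometry.Milne1999.SpecialLefschetzGroupOnePolarizationClass
import Literature.AlgebraicGeometry.HodgeTheory.HodgeGroupExteriorAction
import HarnessLib

/-!
# `ker l(A)` and `L(A)` act on `H•(A(ℂ); ℂ)` through `⋀•` of their action on `H¹`: an element of Milne's Lefschetz group
# is determined by its degree-one component (Milne 1999, §4 Def. 4.3 / Thm. 4.4, §5 Cor. 5.6, Prop. 5.7, Cor. 5.8)

Milne [Def. 4.3, p. 659] defines the Lefschetz group `L(A)` as a subgroup of `GL(V(A)) × 𝔾_m` and lets it act on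
`H^*(A^r) = ⋀^* (V(A)^∨)^{⊕ r}` THROUGH `V(A) = H₁(A)`; the tree's carriers `lefschetzGroup n X` / `specialLefschetzGroup n X`
(`Milne1999/LefschetzGroup`) are instead subgroups of the families `∏ₖ GL(Hᵏ(X(ℂ); ℂ))` admitting a Künneth extension to all
powers that acts on the Lefschetz classes through a character / fixes them (`powClassSimilitudeGroup`, `powClassStabilizer`
of `HodgeTheory/MotivatedGaloisGroup`).  This file proves that the two descriptions agree for an abelian variety: a family of
`ker l(A)(ℂ)` acts on `Hᵏ(A(ℂ); ℂ) = ⋀ᵏH¹` through `⋀ᵏ` of its `H¹`-component, and an element of `ker l(A)(ℂ)` or of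
`L(A)(ℂ)` is determined by that component — the `ker l` analogue of `HodgeTheory/HodgeGroupExteriorAction`
(`hodgeGroup_ext_one`), whose averaging argument (van Geemen 6.4–6.5) we rerun with LEFSCHETZ instead of Hodge classes:

* §1 (Cor. 5.6 / Prop. 5.7 / Cor. 5.8 in class form) — for a HOMOMORPHISM `f : A^{a+1} → A` and a dual pair `(yᵢ), (yᵢ^∨)` of
  bases of `Hᵏ(A)`, `H^{2 dim A - k}(A)`, the Künneth class `Σⱼ pr₁^* f^* yⱼ ∪ pr₂^* yⱼ^∨` on `A^{a+1} × A` is a Lefschetz class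
  (`sum_cross_map_powSucc_mem_divisorClassesSpan`): it is invariant under `S(A^{a+2})(ℂ) = {diag u}` (Cor. 5.6
  `exists_mem_unitaryCentralizerGroup_diagPow_eq`, the intertwining `exteriorPullback_diagPow_map`, and the isometry
  `cupPairing_exteriorPullback_exteriorPullback`), hence Lefschetz by Thm. 4.4 in the invariants form
  (`mem_divisorClassesSpan_of_forall_mem_unitaryCentralizerGroup`).
* §2 — the Künneth machinery of `HodgeGroupExteriorAction` for a Künneth family `G` fixing `lefschetzPowClasses`:
  `cupPairing_apply_dual` (isometry on dual pairs, from Cor. 5.8 `sum_cross_self_mem_divisorClassesSpan`),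
  `kunneth_one_apply_map` (`G₁ f^* = f^* g` for homomorphisms `f : A × A → A`, from §1), and the averaging operator
  `Σ_p w_p (p·pr₁ + pr₂)^*` giving `kunneth_cupPowOne` / `kunneth_cupProduct`.
* §3 — `specialLefschetzGroup_apply_cupPowOne`, `specialLefschetzGroup_map_cupProduct`,
  `specialLefschetzGroup_apply_eq_exteriorPullback` (`g_k = ⋀ᵏ g₁`), `specialLefschetzGroup_ext_one`; for `L(A) = w(𝔾_m)·ker l`
  (`l ∘ w = -2`, p. 659) `lefschetzGroup_ext_one` (`dim A ≥ 1`), and the group isomorphisms `ker l(A)(ℂ) ≅ ker l(A)(ℂ)|_{H¹}`,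
  `L(A)(ℂ) ≅ L(A)(ℂ)|_{H¹}` (`bijective_evalOne_subgroupMap_(special)lefschetzGroup`).
* §4 — family level ⟺ `H¹` level: `ker l ≤ MT ↔ ker l|_{H¹} ≤ MT|_{H¹}`
  (`specialLefschetzGroup_le_mumfordTateGroup_iff_map_le`), Prop. 4.8 (c) `Hg′ = S(A) ↔ Hg|_{H¹} = ker l|_{H¹}`, `Hg = L ↔ MT|_{H¹} = L|_{H¹}`,
  and the `H¹`-form of Prop. 4.8 (a) ⟺ (c): **`Hg(A)(ℂ)|_{H¹} = S(A)(h)(ℂ)` iff no power of `A` supports an exotic Hodge class**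
  (`hodgeGroupOne_eq_unitaryCentralizerGroup_iff_forall_isDivisorGenerated`, `h` a polarization class).

## Relation to the tree

The summit-side files `Summits/HodgeConjecture/HodgeConjecture/Theorems/Ring2HypothesesDescentAbsoluteExteriorLefschetz{Graphs,H1}.lean`
(namespace `Summit.HodgeConjecture.HodgeConjecture.Ring2.Hypotheses`, not importable from `Literature/`) prove the `ker l` half
(§1–§3 up to `specialLefschetzGroup_ext_one`, and Thm. 4.4 as a bijection) for their cell; this file is the Literature-side
statement of that half, by the same route, and adds the `L(A)` half (`lefschetzGroup_ext_one`, `L(A)(ℂ) ≅ L(A)(ℂ)|_{H¹}`) and the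
family ⟺ `H¹` bridges of §4, which are not in the tree.

## Divergence from source

Milne works with algebraic groups over `ℚ` acting on `V(A) = H₁(A, ℚ)`; the tree works with `ℂ`-points acting on
`H¹(A(ℂ); ℂ)` (dual, complexified), and with family-valued groups on `⊕ₖ Hᵏ`; "acts through `⋀•` of `H¹`" is Milne's
DEFINITION and the tree's THEOREM proved here.  `dim A ≥ 1` is needed exactly where scalars must be separated from `ker l`
(`l ∘ w = -2` is vacuous in dimension `0`).

## References

* [Milne1999LefschetzClasses] J. S. Milne, Lefschetz classes on abelian varieties, Duke Math. J. 96 (1999) 639–675,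
  §1 p. 643–644, §4 Def. 4.3, Thm. 4.4, Cor. 4.5, Prop. 4.8 (pp. 657–660), §5 Prop. 5.4, Cor. 5.6, Prop. 5.7, Cor. 5.8 (pp. 663–664).
* [vanGeemen1994HodgeAV] B. van Geemen, An introduction to the Hodge conjecture for abelian varieties, LNM 1594 (1994), 6.4–6.5.
* [VoisinHodgeI2002] C. Voisin, Hodge Theory and Complex Algebraic Geometry I, CUP 2002, §7.1.2, Lemma 11.41.
* [LangeBirkenhake1992] H. Lange, Ch. Birkenhake, Complex Abelian Varieties, Springer 1992, §1.1.
* [Gordon1999HodgeAVSurvey] B. B. Gordon, A survey of the Hodge conjecture for abelian varieties (Appendix B to Lewis), 1999, Thm. 7.5.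
-/

noncomputable section

open CategoryTheory MonoidalCategory CartesianMonoidalCategory
open Literature.AlgebraicTopology.SingularHomology
open Literature.AlgebraicGeometry.Motives
open Literature.AlgebraicGeometry.HodgeTheory
open Literature.AlgebraicGeometry.VanGeemen1994 (pullbackOne hodgeClassSpan)
open Literature.Barriers.HodgeConjecture (divisorClassesSpan)
open Literature.Geometry.Kaehler (lefschetzPow)

namespace Literature.AlgebraicGeometry.Milne1999

/-! ### §1 Cor. 5.6 in class form for homomorphisms `f : A^{a+1} → A`: the Künneth class of `f^*` is Lefschetz -/

section GraphClass

variable {A : AbelianVariety ℂ} {u : complexBetti A.X 1 ≃ₗ[ℂ] complexBetti A.X 1}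

/-- Every complex abelian variety carries a rational class with a Kähler multiple (the hyperplane class of a projective
embedding; the tree's `KaehlerRationalDatum`). [cite: VoisinHodgeI2002, §7.1.2] [cite: Milne1999LefschetzClasses, §4 p. 658] -/
theorem exists_isRationalClass_and_isKaehlerClass_smul (A : AbelianVariety ℂ) :
    ∃ h : complexBetti A.X 2, IsRationalClass h ∧ ∃ s : ℝ, 0 < s ∧ IsKaehlerClass A.dim A.X ((s : ℂ) • h) := by
  obtain ⟨D⟩ := nonempty_kaehlerRationalDatum (AbelianVariety.isSmoothProjective_holds (A := A))
  refine ⟨D.Hη, D.isRationalClass_Hη, 1, one_pos, ?_⟩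
  rw [Complex.ofReal_one, one_smul]
  exact D.isKaehlerClassVia.isKaehlerClass D.isNatural D.isMultiplicative

/-- **`⋀•(u^{⊕(a+1)}) ∘ f^* = f^* ∘ ⋀•u` on `H•(A)` for a homomorphism `f : A^{a+1} → A` and `u ∈ C(A)`** (on `H¹`:
`diagPow_intertwine_right`; `f^* = ⋀•(f^*|_{H¹})`). [cite: Milne1999LefschetzClasses, §1 p. 643] [cite: HatcherAT2002, §3.2 Prop. 3.10] -/
theorem exteriorPullback_diagPow_map (hu : u ∈ centralizerGroup A) (a : ℕ) (f : A.powSucc a ⟶ A) (k : ℕ)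
    (y : complexBetti A.X k) :
    exteriorPullback (AbelianVariety.hasExteriorCohomologyH1_complexPoints (A.powSucc a)) (diagPow A u a).toLinearMap k
        (complexBetti.map f.hom.hom.hom k y) =
      complexBetti.map f.hom.hom.hom k
        (exteriorPullback (AbelianVariety.hasExteriorCohomologyH1_complexPoints A) u.toLinearMap k y) := by
  have hΛ := AbelianVariety.hasExteriorCohomologyH1_complexPoints A
  have hΛa := AbelianVariety.hasExteriorCohomologyH1_complexPoints (A.powSucc a)
  have hf : (complexBetti.map f.hom.hom.hom k).hom =
      exteriorPullback hΛ (complexBetti.map f.hom.hom.hom 1).hom k :=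
    (exteriorPullback_map hΛ (Motives.AlgPoints.mapContinuous (L := ℂ) f.hom.hom.hom) k).symm
  have h1 : (diagPow A u a).toLinearMap.comp (complexBetti.map f.hom.hom.hom 1).hom =
      (complexBetti.map f.hom.hom.hom 1).hom.comp u.toLinearMap :=
    LinearMap.ext fun v ↦ diagPow_intertwine_right hu f v
  have hc : (exteriorPullback hΛa (diagPow A u a).toLinearMap k).comp
        (exteriorPullback hΛ (complexBetti.map f.hom.hom.hom 1).hom k) =
      (exteriorPullback hΛ (complexBetti.map f.hom.hom.hom 1).hom k).comp (exteriorPullback hΛ u.toLinearMap k) := by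
    rw [← exteriorPullback_comp hΛ hΛa, h1, exteriorPullback_comp hΛ hΛ]
  have e := LinearMap.congr_fun hc y
  simp only [LinearMap.comp_apply] at e
  rw [← hf] at e
  exact e

/-- **Milne 1999, Cor. 5.6 («the graph of a homomorphism of abelian varieties is Lefschetz») with Cor. 5.8, in class form, for
a homomorphism `f : A^{a+1} → A`**: for `0 < dim A = n`, `k + d = 2n` and ANY dual pair `(yⱼ)`, `(yⱼ^∨)` of the cup pairing
`Hᵏ(A) × Hᵈ(A) → ℂ`, the Künneth class `Σⱼ pr_{A^{a+1}}^* f^*(yⱼ) ∪ pr_A^* yⱼ^∨ ∈ H^{2n}((A^{a+1} × A)(ℂ); ℂ)` of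
`f^* : Hᵏ(A) → Hᵏ(A^{a+1})` lies in `Dⁿ_hom(A^{a+2})_ℂ`. Proof (Prop. 5.7): the class is fixed by
`S(A^{a+2})(ℂ) = {u^{⊕(a+2)}}` (`exists_mem_unitaryCentralizerGroup_diagPow_eq`) — `u^{⊕(a+2)} = u^{⊕(a+1)} ⊕ u` acts on it through
`⋀•u^{⊕(a+1)} ∘ f^* = f^* ∘ ⋀•u` and the `⋀•u`-invariance of the canonical element `Σⱼ yⱼ ⊗ yⱼ^∨` (`det u = 1`) — and the
`S(A^{a+2})(ℂ)`-invariants are Lefschetz (Cor. 4.5 / Thm. 3.2 on `A^{a+2}`, `mem_divisorClassesSpan_of_forall_mem_unitaryCentralizerGroup`).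
[cite: Milne1999LefschetzClasses, Cor. 5.6 (p. 663), Prop. 5.7, Cor. 5.8 (p. 664), Cor. 4.5 (p. 659)] -/
theorem sum_cross_map_powSucc_mem_divisorClassesSpan (hA0 : 0 < A.dim) (a : ℕ) (f : A.powSucc a ⟶ A) {k d : ℕ}
    (hkd : k + d = 2 * A.dim) (μ : OrientationFamily) {ι : Type} [Fintype ι] [DecidableEq ι]
    (y : Module.Basis ι ℂ (complexBetti A.X k)) {yd : ι → complexBetti A.X d}
    (hyd : ∀ i j, cupPairing (μ (AbelianVariety.isSmoothProjective_holds (A := A))) hkd (y i) (yd j) =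
      if i = j then 1 else 0) :
    (∑ j, cupProduct hkd
        (complexBetti.map (AbelianVariety.fst (A.powSucc a) A).hom.hom.hom k (complexBetti.map f.hom.hom.hom k (y j)))
        (complexBetti.map (AbelianVariety.snd (A.powSucc a) A).hom.hom.hom d (yd j)) :
        complexBetti (A.powSucc (a + 1)).X (2 * A.dim)) ∈
      divisorClassesSpan (A.powSucc (a + 1)).X (A.powSucc (a + 1)).dim A.dim := by
  classical
  have hX : IsSmoothProjective A.dim A.X := AbelianVariety.isSmoothProjective_holds (A := A)
  have hΛ := AbelianVariety.hasExteriorCohomologyH1_complexPoints A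
  obtain ⟨h, hQ, s, hs, hK⟩ := exists_isRationalClass_and_isKaehlerClass_smul A
  have hh : h ∈ hodgeClassSpan A.dim A.X 1 := mem_hodgeClassSpan_one_of_isKaehlerClass_smul hQ hs.ne' hK
  have htop : lefschetzPow h (A.dim - 1) 2 h ≠ 0 := lefschetzPow_self_ne_zero_of_isKaehlerClass_smul hA0 hK
  have hnd : ∀ x : complexBetti A.X 1, (∀ z, polarizationPairingOne A.X h (A.dim - 1) x z = 0) → x = 0 :=
    fun x hx ↦ eq_zero_of_forall_polarizationPairingOne_eq_zero_of_isKaehlerClass_smul' hs.ne' hK x hx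
  refine mem_divisorClassesSpan_of_forall_mem_unitaryCentralizerGroup (A.powSucc (a + 1))
    (powPolarizationClass_mem_hodgeClassSpan hh (a + 1))
    (eq_zero_of_forall_polarizationPairingOne_powPolarizationClass_eq_zero hA0 htop hnd (a + 1)) A.dim _ ?_
  intro U hU
  obtain ⟨u, hu, rfl⟩ := exists_mem_unitaryCentralizerGroup_diagPow_eq hA0 htop (a + 1) U hU
  rw [map_sum]
  have hdet : LinearMap.det (u : complexBetti A.X 1 →ₗ[ℂ] complexBetti A.X 1) = 1 :=
    det_eq_one_of_mem_unitaryCentralizerGroup hQ ⟨s, hs, hK⟩ hu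
  -- the bilinear map `Φ(v, w) = pr^* f^* v ∪ pr_A^* w`
  let Φ : complexBetti A.X k →ₗ[ℂ] complexBetti A.X d →ₗ[ℂ] complexBetti ((A.powSucc a).prod A).X (2 * A.dim) :=
    ((cupProduct hkd) ∘ₗ ((complexBetti.map (AbelianVariety.fst (A.powSucc a) A).hom.hom.hom k).hom ∘ₗ
      (complexBetti.map f.hom.hom.hom k).hom)).compl₂ (complexBetti.map (AbelianVariety.snd (A.powSucc a) A).hom.hom.hom d).hom
  have hΦ : ∀ v w, Φ v w = cupProduct hkd
      (complexBetti.map (AbelianVariety.fst (A.powSucc a) A).hom.hom.hom k (complexBetti.map f.hom.hom.hom k v))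
      (complexBetti.map (AbelianVariety.snd (A.powSucc a) A).hom.hom.hom d w) := fun v w ↦ rfl
  -- the moved dual pair `(⋀ᵏu yⱼ, ⋀ᵈu yⱼ^∨)`
  let y' : Module.Basis ι ℂ (complexBetti A.X k) := y.map (exteriorPullbackEquiv hΛ u k)
  have hy' : ∀ j, y' j = exteriorPullback hΛ (u : complexBetti A.X 1 →ₗ[ℂ] complexBetti A.X 1) k (y j) :=
    fun j ↦ by rw [Module.Basis.map_apply, exteriorPullbackEquiv_apply]
  have hyd' : ∀ i j, cupPairing (μ hX) hkd (y' i)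
      (exteriorPullback hΛ (u : complexBetti A.X 1 →ₗ[ℂ] complexBetti A.X 1) d (yd j)) = if i = j then 1 else 0 := by
    intro i j
    rw [hy', cupPairing_exteriorPullback_exteriorPullback (μ hX) u hdet hkd, hyd]
  have key := PerfPairDuality.sum_dual_eq_sum_dual (isPerfPair_cupPairing_complexPoints μ hX hkd) y hyd y' hyd' Φ
  -- `u^{⊕(a+2)} = u^{⊕(a+1)} ⊕ u` acts factorwise on the cross products, and `⋀•u^{⊕(a+1)} f^* = f^* ⋀•u`
  have step : ∀ j, exteriorPullback (AbelianVariety.hasExteriorCohomologyH1_complexPoints (A.powSucc (a + 1)))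
      (diagPow A u (a + 1)).toLinearMap (2 * A.dim)
      (cupProduct hkd
        (complexBetti.map (AbelianVariety.fst (A.powSucc a) A).hom.hom.hom k (complexBetti.map f.hom.hom.hom k (y j)))
        (complexBetti.map (AbelianVariety.snd (A.powSucc a) A).hom.hom.hom d (yd j))) =
      Φ (y' j) (exteriorPullback hΛ (u : complexBetti A.X 1 →ₗ[ℂ] complexBetti A.X 1) d (yd j)) := by
    intro j
    rw [hΦ, hy', ← exteriorPullback_diagPow_map hu.1 a f k (y j)]
    exact exteriorPullback_prodBlockDiagEquiv_cross (s := diagPow A u a) (t := u) hkd _ _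
  calc ∑ j, exteriorPullback (AbelianVariety.hasExteriorCohomologyH1_complexPoints (A.powSucc (a + 1)))
          (diagPow A u (a + 1)).toLinearMap (2 * A.dim)
          (cupProduct hkd
            (complexBetti.map (AbelianVariety.fst (A.powSucc a) A).hom.hom.hom k (complexBetti.map f.hom.hom.hom k (y j)))
            (complexBetti.map (AbelianVariety.snd (A.powSucc a) A).hom.hom.hom d (yd j)))
      = ∑ j, Φ (y' j) (exteriorPullback hΛ (u : complexBetti A.X 1 →ₗ[ℂ] complexBetti A.X 1) d (yd j)) :=
        Finset.sum_congr rfl fun j _ ↦ step j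
    _ = ∑ j, Φ (y j) (yd j) := key.symm
    _ = _ := Finset.sum_congr rfl fun j _ ↦ hΦ _ _

end GraphClass

/-! ### §2 The Künneth machinery of `HodgeTheory/HodgeGroupExteriorAction` run for a family fixing the LEFSCHETZ classes -/

namespace LefschetzGroupExterior

open HodgeTheory.HodgeGroupExterior (sum_smul_eq_of_sum_cross_eq cupPowOne_smul_add cupPowOne_eq_sign_smul_cons)

variable (A : AbelianVariety ℂ)
  {g : ∀ k : ℕ, complexBetti A.X k ≃ₗ[ℂ] complexBetti A.X k}
  {G : ∀ a k : ℕ, complexBetti (cartesianPow A.X (a + 1)) k ≃ₗ[ℂ] complexBetti (cartesianPow A.X (a + 1)) k}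
  {G1 : ∀ k : ℕ, complexBetti (A.X ⊗ A.X) k ≃ₗ[ℂ] complexBetti (A.X ⊗ A.X) k}

variable {A} in
/-- `map_cross` at the first power, read on `g = G₀` (typed copy). [folklore] -/
private theorem cross_zero (hG : IsKunnethFamily A.X G) (h0 : G 0 = g) (i j k : ℕ) (h : i + j = k)
    (x : complexBetti A.X i) (y : complexBetti A.X j) :
    G 1 k (cupProduct h (complexBetti.map (fst A.X A.X) i x) (complexBetti.map (snd A.X A.X) j y)) =
      cupProduct h (complexBetti.map (fst A.X A.X) i (g i x)) (complexBetti.map (snd A.X A.X) j (g j y)) := by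
  have := hG.map_cross 0 i j k h x y
  rw [h0] at this
  exact this

variable {A} in
/-- `map_cross` at the second power, the last factor read on `g = G₀` (typed copy). [folklore] -/
private theorem cross_two (hG : IsKunnethFamily A.X G) (h0 : G 0 = g) (h1 : G 1 = G1) (i j k : ℕ) (h : i + j = k)
    (x : complexBetti (A.X ⊗ A.X) i) (y : complexBetti A.X j) :
    G 2 k (cupProduct h (complexBetti.map (fst (cartesianPow A.X 2) A.X) i x)
        (complexBetti.map (snd (cartesianPow A.X 2) A.X) j y)) =
      cupProduct h (complexBetti.map (fst (cartesianPow A.X 2) A.X) i (G1 i x))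
        (complexBetti.map (snd (cartesianPow A.X 2) A.X) j (g j y)) := by
  have := hG.map_cross 1 i j k h x y
  rw [h0, h1] at this
  exact this

variable {A} in
/-- **The Künneth class of the identity of `Hᵏ(A)` is a Lefschetz class on `A^{×2}`** (Milne Cor. 5.8, the tree's
`sum_cross_self_mem_divisorClassesSpan`, in the spelling `lefschetzPowClasses` of `Milne1999/LefschetzGroup`, for a dual
pair with constant `c ≠ 0`). [cite: Milne1999LefschetzClasses, Cor. 5.8 (p. 664)] -/
theorem sum_cross_self_mem_lefschetzPowClasses (hX : IsSmoothProjective A.dim A.X) (hA0 : 0 < A.dim) {k d : ℕ} (hkd : k + d = 2 * A.dim)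
    (μ : OrientationFamily) {ι : Type} [Fintype ι] [DecidableEq ι] (x : Module.Basis ι ℂ (complexBetti A.X k))
    {xd : ι → complexBetti A.X d} {c : ℂ} (hc : c ≠ 0)
    (hd : ∀ i j, cupPairing (μ hX) hkd (x i) (xd j) =
      if i = j then c else 0) :
    (∑ i, cupProduct hkd (complexBetti.map (fst A.X A.X) k (x i)) (complexBetti.map (snd A.X A.X) d (xd i)) :
        complexBetti (cartesianPow A.X 2) (2 * A.dim)) ∈ lefschetzPowClasses A.dim A.X 1 A.dim := by
  have hnorm : ∀ i j, cupPairing (μ hX) hkd (x i) (c⁻¹ • xd j) =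
      if i = j then 1 else 0 := by
    intro i j
    rw [map_smul, hd, smul_eq_mul]
    split_ifs
    · exact inv_mul_cancel₀ hc
    · exact mul_zero _
  have h' := sum_cross_self_mem_divisorClassesSpan A hA0 hkd μ x hnorm
  have h'' : (∑ i, cupProduct hkd (complexBetti.map (fst A.X A.X) k (x i)) (complexBetti.map (snd A.X A.X) d (c⁻¹ • xd i)) :
      complexBetti (cartesianPow A.X 2) (2 * A.dim)) ∈ divisorClassesSpan (cartesianPow A.X 2) (A.powSucc 1).dim A.dim := h'
  show _ ∈ divisorClassesSpan (cartesianPow A.X 2) (cartesianPowDim A.dim 1) A.dim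
  rw [← AbelianVariety.dim_powSucc_eq_cartesianPowDim (A := A) 1]
  have e : (∑ i, cupProduct hkd (complexBetti.map (fst A.X A.X) k (x i)) (complexBetti.map (snd A.X A.X) d (xd i)) :
      complexBetti (cartesianPow A.X 2) (2 * A.dim)) =
      c • ∑ i, cupProduct hkd (complexBetti.map (fst A.X A.X) k (x i)) (complexBetti.map (snd A.X A.X) d (c⁻¹ • xd i)) := by
    rw [Finset.smul_sum]
    refine Finset.sum_congr rfl fun i _ ↦ ?_
    rw [map_smul, map_smul, smul_smul, mul_inv_cancel₀ hc, one_smul]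
  rw [e]
  exact Submodule.smul_mem _ _ h''

variable {A} in
/-- **The Künneth class of `f^*` for a homomorphism `f : A × A → A` is a Lefschetz class on `A^{×3}`** (Cor. 5.6 / §1 of this
file, in the spelling `lefschetzPowClasses`, dual pair with constant `c ≠ 0`). [cite: Milne1999LefschetzClasses, Cor. 5.6 (p. 663) and Cor. 5.8] -/
theorem sum_cross_map_mem_lefschetzPowClasses_two (hX : IsSmoothProjective A.dim A.X) (hA0 : 0 < A.dim) (φ : A.prod A ⟶ A) (f : A.X ⊗ A.X ⟶ A.X)
    (hf : φ.hom.hom.hom = f) {k d : ℕ}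
    (hkd : k + d = 2 * A.dim) (μ : OrientationFamily) {ι : Type} [Fintype ι] [DecidableEq ι]
    (x : Module.Basis ι ℂ (complexBetti A.X k)) {xd : ι → complexBetti A.X d} {c : ℂ} (hc : c ≠ 0)
    (hd : ∀ i j, cupPairing (μ hX) hkd (x i) (xd j) =
      if i = j then c else 0) :
    (∑ i, cupProduct hkd
        (complexBetti.map (fst (cartesianPow A.X 2) A.X) k (complexBetti.map f k (x i)))
        (complexBetti.map (snd (cartesianPow A.X 2) A.X) d (xd i)) :
        complexBetti (cartesianPow A.X 3) (2 * A.dim)) ∈ lefschetzPowClasses A.dim A.X 2 A.dim := by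
  have hnorm : ∀ i j, cupPairing (μ hX) hkd (x i) (c⁻¹ • xd j) = if i = j then 1 else 0 := by
    intro i j
    rw [map_smul, hd, smul_eq_mul]
    split_ifs
    · exact inv_mul_cancel₀ hc
    · exact mul_zero _
  have h'' : (∑ i, cupProduct hkd
      (complexBetti.map (fst (cartesianPow A.X 2) A.X) k (complexBetti.map f k (x i)))
      (complexBetti.map (snd (cartesianPow A.X 2) A.X) d (c⁻¹ • xd i)) : complexBetti (cartesianPow A.X 3) (2 * A.dim)) ∈
      divisorClassesSpan (cartesianPow A.X 3) (A.powSucc 2).dim A.dim := by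
    subst hf
    exact sum_cross_map_powSucc_mem_divisorClassesSpan hA0 1 φ hkd μ x hnorm
  show _ ∈ divisorClassesSpan (cartesianPow A.X 3) (cartesianPowDim A.dim 2) A.dim
  rw [← AbelianVariety.dim_powSucc_eq_cartesianPowDim (A := A) 2]
  have e : (∑ i, cupProduct hkd
      (complexBetti.map (fst (cartesianPow A.X 2) A.X) k (complexBetti.map f k (x i)))
      (complexBetti.map (snd (cartesianPow A.X 2) A.X) d (xd i)) : complexBetti (cartesianPow A.X 3) (2 * A.dim)) =
      c • ∑ i, cupProduct hkd
        (complexBetti.map (fst (cartesianPow A.X 2) A.X) k (complexBetti.map f k (x i)))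
        (complexBetti.map (snd (cartesianPow A.X 2) A.X) d (c⁻¹ • xd i)) := by
    rw [Finset.smul_sum]
    refine Finset.sum_congr rfl fun i _ ↦ ?_
    rw [map_smul, map_smul, smul_smul, mul_inv_cancel₀ hc, one_smul]
  rw [e]
  exact Submodule.smul_mem _ _ h''

variable {A} in
/-- **A family of `ker l(A)(ℂ)` is an isometry of the cup pairing, on a dual pair** (the `Hg` version is
`HodgeGroupExterior.cupPairing_apply_dual`; here the fixed class `Σᵢ pr₁^* xᵢ ∪ pr₂^* xᵢ^∨` on `A^{×2}` is LEFSCHETZ, Cor. 5.8):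
`⟨u ∪ g xᵢ^∨, [A]⟩ = ⟨g⁻¹u ∪ xᵢ^∨, [A]⟩`. [cite: Milne1999LefschetzClasses, Cor. 5.8 (p. 664) and Prop. 5.4 (p. 663)] -/
theorem cupPairing_apply_dual (hX : IsSmoothProjective A.dim A.X) (hA0 : 0 < A.dim) (hG : IsKunnethFamily A.X G) (h0 : G 0 = g)
    (hfix : ∀ (a p : ℕ), ∀ x ∈ lefschetzPowClasses A.dim A.X a p, G a (2 * p) x = x)
    {k d : ℕ} (hkd : k + d = 2 * A.dim) {ι : Type} [Fintype ι] [DecidableEq ι]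
    (x : Module.Basis ι ℂ (complexBetti A.X k)) {xd : ι → complexBetti A.X d} (μ : OrientationFamily) {c : ℂ}
    (hc : c ≠ 0)
    (hd : ∀ i j, cupPairing (μ hX) hkd (x i) (xd j) =
      if i = j then c else 0)
    (u : complexBetti A.X k) (i : ι) :
    cupPairing (μ hX) hkd u (g d (xd i)) =
      cupPairing (μ hX) hkd ((g k).symm u) (xd i) := by
  classical
  set γ : complexBetti (cartesianPow A.X 2) (2 * A.dim) :=
    ∑ i, cupProduct hkd (complexBetti.map (fst A.X A.X) k (x i)) (complexBetti.map (snd A.X A.X) d (xd i)) with hγ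
  have hγmem : γ ∈ lefschetzPowClasses A.dim A.X 1 A.dim := sum_cross_self_mem_lefschetzPowClasses hX hA0 hkd μ x hc hd
  have hinv := hfix 1 A.dim γ hγmem
  have hGγ : G 1 (2 * A.dim) γ = ∑ i, cupProduct hkd (complexBetti.map (fst A.X A.X) k (g k (x i)))
      (complexBetti.map (snd A.X A.X) d (g d (xd i))) := by
    rw [hγ, map_sum]
    exact Finset.sum_congr rfl fun i _ ↦ cross_zero hG h0 k d (2 * A.dim) hkd (x i) (xd i)
  rw [hGγ, hγ] at hinv
  -- normalised dual and expansion
  have hnorm : ∀ i j, cupPairing (μ hX) hkd (x i) (c⁻¹ • xd j) = if i = j then 1 else 0 := by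
    intro i j
    rw [map_smul, hd, smul_eq_mul]
    split_ifs
    · exact inv_mul_cancel₀ hc
    · exact mul_zero _
  have hexp : ∀ w : complexBetti A.X k, ∑ i, cupPairing (μ hX) hkd w (xd i) • x i = c • w := by
    intro w
    have h1 := PerfPairDuality.eq_sum_smul_self x hnorm w
    rw [h1, Finset.smul_sum]
    conv_lhs => rw [← h1]
    refine Finset.sum_congr rfl fun i _ ↦ ?_
    rw [map_smul, smul_eq_mul, smul_smul, mul_inv_cancel_left₀ hc]
  have key : ∀ w : complexBetti A.X k,
      ∑ i, cupPairing (μ hX) hkd w (g d (xd i)) • g k (x i) = c • w := fun w ↦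
    (sum_smul_eq_of_sum_cross_eq hX hX hkd (by omega) (fun i ↦ g k (x i)) (fun i ↦ x i)
      (fun i ↦ g d (xd i)) (fun i ↦ xd i) hinv (cupPairing (μ hX) hkd w)).trans (hexp w)
  have key' : ∑ i, cupPairing (μ hX) hkd u (g d (xd i)) • x i =
      ∑ i, cupPairing (μ hX) hkd ((g k).symm u) (xd i) • x i := by
    have h := congrArg (g k).symm (key u)
    rw [map_sum] at h
    simp_rw [map_smul, LinearEquiv.symm_apply_apply] at h
    rw [h, hexp]
  exact Fintype.linearIndependent_iffₛ.1 x.linearIndependent _ _ key' i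

variable {A} in
/-- **The Künneth extension `G₁` commutes with `f^*` for every HOMOMORPHISM `f : A × A → A`** (the `Hg` version is
`HodgeGroupExterior.kunneth_apply_map`; here the fixed class `Σᵢ pr₁^* f^* xᵢ ∪ pr₂^* xᵢ^∨` on `A^{×3}` is LEFSCHETZ, Cor. 5.6):
`G₁ (f^* y) = f^* (g y)`. [cite: Milne1999LefschetzClasses, Cor. 5.6 (p. 663) and Prop. 5.7 (p. 664)] -/
theorem kunneth_one_apply_map (hA0 : 0 < A.dim) (hG : IsKunnethFamily A.X G) (h0 : G 0 = g) (h1 : G 1 = G1)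
    (hfix : ∀ (a p : ℕ), ∀ x ∈ lefschetzPowClasses A.dim A.X a p, G a (2 * p) x = x)
    (φ : A.prod A ⟶ A) (f : A.X ⊗ A.X ⟶ A.X) (hf : φ.hom.hom.hom = f) (k : ℕ) (y : complexBetti A.X k) :
    G1 k (complexBetti.map f k y) = complexBetti.map f k (g k y) := by
  classical
  have hX : IsSmoothProjective A.dim A.X := AbelianVariety.isSmoothProjective_holds (A := A)
  by_cases hk : 2 * A.dim < k
  · haveI := subsingleton_complexBetti hX hk
    have hy : y = 0 := Subsingleton.elim y 0
    subst hy
    simp only [map_zero]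
  obtain ⟨d, hkd⟩ : ∃ d, k + d = 2 * A.dim := ⟨2 * A.dim - k, by omega⟩
  let μ : OrientationFamily := complexOrientationFamily
  obtain ⟨N, x, xd, c, hc, -, -, hdual⟩ := exists_rational_dual μ hX hkd
  have hXa := isSmoothProjective_cartesianPow hX 1
  set γ : complexBetti (cartesianPow A.X 3) (2 * A.dim) :=
    ∑ i, cupProduct hkd (complexBetti.map (fst (cartesianPow A.X 2) A.X) k (complexBetti.map f k (x i)))
      (complexBetti.map (snd (cartesianPow A.X 2) A.X) d (xd i)) with hγ
  have hγmem : γ ∈ lefschetzPowClasses A.dim A.X 2 A.dim :=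
    sum_cross_map_mem_lefschetzPowClasses_two hX hA0 φ f hf hkd μ x hc hdual
  have hinv := hfix 2 A.dim γ hγmem
  have hGγ : G 2 (2 * A.dim) γ =
      ∑ i, cupProduct hkd (complexBetti.map (fst (cartesianPow A.X 2) A.X) k (G1 k (complexBetti.map f k (x i))))
        (complexBetti.map (snd (cartesianPow A.X 2) A.X) d (g d (xd i))) := by
    rw [hγ, map_sum]
    exact Finset.sum_congr rfl fun i _ ↦ cross_two hG h0 h1 k d (2 * A.dim) hkd _ (xd i)
  rw [hGγ, hγ] at hinv
  have hnorm : ∀ i j, cupPairing (μ hX) hkd (x i) (c⁻¹ • xd j) = if i = j then 1 else 0 := by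
    intro i j
    rw [map_smul, hdual, smul_eq_mul]
    split_ifs
    · exact inv_mul_cancel₀ hc
    · exact mul_zero _
  have hexp : ∀ w : complexBetti A.X k, ∑ i, cupPairing (μ hX) hkd w (xd i) • x i = c • w := by
    intro w
    have h1 := PerfPairDuality.eq_sum_smul_self x hnorm w
    rw [h1, Finset.smul_sum]
    conv_lhs => rw [← h1]
    refine Finset.sum_congr rfl fun i _ ↦ ?_
    rw [map_smul, smul_eq_mul, smul_smul, mul_inv_cancel_left₀ hc]
  have h := sum_smul_eq_of_sum_cross_eq hXa hX hkd (by omega)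
    (fun i ↦ G1 k (complexBetti.map f k (x i))) (fun i ↦ complexBetti.map f k (x i))
    (fun i ↦ g d (xd i)) (fun i ↦ xd i) hinv (cupPairing (μ hX) hkd (g k y))
  have hR : ∑ i, cupPairing (μ hX) hkd (g k y) (xd i) • complexBetti.map f k (x i) =
      c • complexBetti.map f k (g k y) := by
    rw [← map_smul, ← hexp (g k y), map_sum]
    simp_rw [map_smul]
  have hL : ∑ i, cupPairing (μ hX) hkd (g k y) (g d (xd i)) • G1 k (complexBetti.map f k (x i)) =
      c • G1 k (complexBetti.map f k y) := by
    simp_rw [cupPairing_apply_dual hX hA0 hG h0 hfix hkd x μ hc hdual (g k y)]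
    rw [LinearEquiv.symm_apply_apply, ← map_smul, ← map_smul, ← hexp y, map_sum, map_sum]
    simp_rw [map_smul]
  have h' : c • G1 k (complexBetti.map f k y) = c • complexBetti.map f k (g k y) := by
    rw [← hL, ← hR]; exact h
  exact smul_right_injective _ hc h'

/-! #### The averaging operator and the exterior action (van Geemen 6.5 / Milne Thm. 4.4, for `ker l`)

The homomorphisms `f_p = p·pr₁ + pr₂ : A × A → A` enter only through two properties of the scheme morphisms
`F p : A × A → A` underlying them: `(F p)^* x = p·pr₁^* x + pr₂^* x` on `H¹` and `G₁ (F p)^* = (F p)^* g` (from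
`kunneth_one_apply_map`); the averaging lemmas are stated for any such `F` (no auxiliary definitions). -/

/-- `f_p^* x = p·pr₁^* x + pr₂^* x` on `H¹(A(ℂ); ℂ)` for `f_p = p·pr₁ + pr₂ : A × A → A`. [cite: LangeBirkenhake1992, §1.1 (p. 19)] -/
theorem map_nsmul_fst_add_snd_one (p : ℕ) (x : complexBetti A.X 1) :
    complexBetti.map (X := A.X ⊗ A.X) (Y := A.X) (p • AbelianVariety.fst A A + AbelianVariety.snd A A).hom.hom.hom 1 x =
      (p : ℂ) • complexBetti.map (fst A.X A.X) 1 x + complexBetti.map (snd A.X A.X) 1 x := by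
  change complexBetti.map (p • AbelianVariety.fst A A + AbelianVariety.snd A A).hom.hom.hom 1 x = _
  rw [complexBetti_map_add_one, complexBetti_map_nsmul_one]
  change ((p • complexBetti.map (AbelianVariety.fst A A).hom.hom.hom 1 +
    complexBetti.map (AbelianVariety.snd A A).hom.hom.hom 1).hom) x = _
  rw [ModuleCat.hom_add, ModuleCat.hom_nsmul, LinearMap.add_apply, LinearMap.smul_apply,
    Nat.cast_smul_eq_nsmul]
  rfl

/-- `Δ^* pr₁^* = id` for the diagonal `Δ = (𝟙, 𝟙) : A → A × A`. [folklore] -/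
private theorem diag_map_fst (k : ℕ) (x : complexBetti A.X k) :
    complexBetti.map (CartesianMonoidalCategory.lift (𝟙 A.X) (𝟙 A.X)) k (complexBetti.map (fst A.X A.X) k x) = x := by
  rw [← ModuleCat.comp_apply, ← complexBetti.map_comp, CartesianMonoidalCategory.lift_fst,
    complexBetti.map_id, ModuleCat.id_apply]

/-- `Δ^* pr₂^* = id`. [folklore] -/
private theorem diag_map_snd (k : ℕ) (x : complexBetti A.X k) :
    complexBetti.map (CartesianMonoidalCategory.lift (𝟙 A.X) (𝟙 A.X)) k (complexBetti.map (snd A.X A.X) k x) = x := by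
  rw [← ModuleCat.comp_apply, ← complexBetti.map_comp, CartesianMonoidalCategory.lift_snd,
    complexBetti.map_id, ModuleCat.id_apply]

/-- `Δ^* M_i(v) = v₀ ∪ ⋯ ∪ v_k` for the one-`pr₁`-factor monomials `M_i(v) = pr₂^*v₀ ∪ ⋯ ∪ pr₁^*v_i ∪ ⋯ ∪ pr₂^*v_k`. [folklore] -/
private theorem diag_map_M1 (k : ℕ) (v : Fin k → complexBetti A.X 1) (i : Fin k) :
    complexBetti.map (CartesianMonoidalCategory.lift (𝟙 A.X) (𝟙 A.X)) k
        (cupPowOne ℂ (ComplexPoints (A.X ⊗ A.X)) k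
          (Function.update (fun j ↦ complexBetti.map (snd A.X A.X) 1 (v j)) i (complexBetti.map (fst A.X A.X) 1 (v i)))) =
      cupPowOne ℂ (ComplexPoints A.X) k v := by
  classical
  rw [complexBetti_map_cupPowOne]
  congr 1
  funext j
  by_cases hj : j = i
  · subst hj
    rw [Function.update_self, diag_map_fst]
  · rw [Function.update_of_ne hj, diag_map_snd]

/-- `M_i(v) = (-1)^i · pr₁^* v_i ∪ pr₂^*(∪_{j ≠ i} v_j)`. [folklore] -/
private theorem M1_eq (k : ℕ) (v : Fin (k + 1) → complexBetti A.X 1) (i : Fin (k + 1)) :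
    cupPowOne ℂ (ComplexPoints (A.X ⊗ A.X)) (k + 1)
        (Function.update (fun j ↦ complexBetti.map (snd A.X A.X) 1 (v j)) i (complexBetti.map (fst A.X A.X) 1 (v i))) =
      ((-1 : ℂ) ^ (i : ℕ)) •
      cupProduct (Nat.add_comm 1 k) (complexBetti.map (fst A.X A.X) 1 (v i))
        (complexBetti.map (snd A.X A.X) k (cupPowOne ℂ (ComplexPoints A.X) k (v ∘ i.succAbove))) := by
  classical
  rw [cupPowOne_eq_sign_smul_cons k _ i]
  congr 1
  rw [← cupProduct_cupPowOne, Function.update_self, complexBetti_map_cupPowOne]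
  congr 2
  funext j
  simp only [Function.comp_apply]
  rw [Function.update_of_ne (Fin.succAbove_ne i j)]

variable {A}

/-- `map_cross` at the first power, read on `g = G₀` and the typed copy `G₁` of `G 1`. [folklore] -/
private theorem cross_one (hG : IsKunnethFamily A.X G) (h0 : G 0 = g) (h1 : G 1 = G1) (i j k : ℕ) (h : i + j = k)
    (x : complexBetti A.X i) (y : complexBetti A.X j) :
    G1 k (cupProduct h (complexBetti.map (fst A.X A.X) i x) (complexBetti.map (snd A.X A.X) j y)) =
      cupProduct h (complexBetti.map (fst A.X A.X) i (g i x)) (complexBetti.map (snd A.X A.X) j (g j y)) := by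
  have := hG.map_cross 0 i j k h x y
  rw [h0, h1] at this
  exact this

/-- The induction step on the `G`-side: `G₁ M_i(v) = M_i(g ∘ v)`, granted the claim in degree `k`. [folklore] -/
private theorem kunneth_M1 (hG : IsKunnethFamily A.X G) (h0 : G 0 = g) (h1 : G 1 = G1) (k : ℕ)
    (ih : ∀ u : Fin k → complexBetti A.X 1,
      g k (cupPowOne ℂ (ComplexPoints A.X) k u) = cupPowOne ℂ (ComplexPoints A.X) k (fun j ↦ g 1 (u j)))
    (v : Fin (k + 1) → complexBetti A.X 1) (i : Fin (k + 1)) :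
    G1 (k + 1) (cupPowOne ℂ (ComplexPoints (A.X ⊗ A.X)) (k + 1)
        (Function.update (fun j ↦ complexBetti.map (snd A.X A.X) 1 (v j)) i (complexBetti.map (fst A.X A.X) 1 (v i)))) =
      cupPowOne ℂ (ComplexPoints (A.X ⊗ A.X)) (k + 1)
        (Function.update (fun j ↦ complexBetti.map (snd A.X A.X) 1 (g 1 (v j))) i
          (complexBetti.map (fst A.X A.X) 1 (g 1 (v i)))) := by
  rw [M1_eq, M1_eq A k (fun j ↦ g 1 (v j)) i, map_smul, cross_one hG h0 h1, ih]
  rfl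

/-- Weights `w₀, …, w_{K+1}` with `Σ_p w_p p^r = [r = 1]` for `r ≤ K + 1` (inverse Vandermonde). [folklore] -/
private theorem exists_lagrangeWeights (K : ℕ) :
    ∃ w : Fin (K + 2) → ℂ, ∀ r : Fin (K + 2),
      ∑ p : Fin (K + 2), w p * ((p : ℕ) : ℂ) ^ (r : ℕ) = if (r : ℕ) = 1 then 1 else 0 := by
  classical
  let V : Matrix (Fin (K + 2)) (Fin (K + 2)) ℂ := Matrix.vandermonde fun p ↦ ((p : ℕ) : ℂ)
  have hV : IsUnit V.det := by
    rw [isUnit_iff_ne_zero, Matrix.det_vandermonde_ne_zero_iff]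
    intro p q hpq
    simp only at hpq
    exact Fin.ext (Nat.cast_injective hpq)
  let e : Fin (K + 2) → ℂ := Pi.single 1 1
  refine ⟨Matrix.vecMul e V⁻¹, fun r ↦ ?_⟩
  have h : Matrix.vecMul (Matrix.vecMul e V⁻¹) V = e := by
    rw [Matrix.vecMul_vecMul, Matrix.nonsing_inv_mul _ hV, Matrix.vecMul_one]
  have hr := congrFun h r
  rw [Matrix.vecMul, dotProduct] at hr
  simp only [V, Matrix.vandermonde_apply] at hr
  rw [hr]
  simp only [e, Pi.single_apply]
  have : (r = 1) ↔ ((r : ℕ) = 1) := by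
    constructor
    · rintro rfl; rfl
    · intro h1; exact Fin.ext h1
  simp only [this]

/-- **Averaging, expansion step**: for scheme morphisms `F p : A × A → A` acting on `H¹` by `p·pr₁^* + pr₂^*` and Lagrange
weights `w`, `Σ_p w_p (F p)^* (v₀ ∪ ⋯ ∪ v_k) = Σ_i M_i(v)`. [cite: vanGeemen1994HodgeAV, 6.5] -/
private theorem avg_cupPowOne {k : ℕ} {w : Fin (k + 2) → ℂ}
    (hw : ∀ r : Fin (k + 2), ∑ p : Fin (k + 2), w p * ((p : ℕ) : ℂ) ^ (r : ℕ) = if (r : ℕ) = 1 then 1 else 0)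
    (F : ℕ → (A.X ⊗ A.X ⟶ A.X))
    (hF1 : ∀ (p : ℕ) (x : complexBetti A.X 1), complexBetti.map (F p) 1 x =
      (p : ℂ) • complexBetti.map (fst A.X A.X) 1 x + complexBetti.map (snd A.X A.X) 1 x)
    (v : Fin (k + 1) → complexBetti A.X 1) :
    ∑ p : Fin (k + 2), w p • complexBetti.map (F p) (k + 1) (cupPowOne ℂ (ComplexPoints A.X) (k + 1) v) =
      ∑ i : Fin (k + 1), cupPowOne ℂ (ComplexPoints (A.X ⊗ A.X)) (k + 1)
        (Function.update (fun j ↦ complexBetti.map (snd A.X A.X) 1 (v j)) i (complexBetti.map (fst A.X A.X) 1 (v i))) := by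
  classical
  have hexp : ∀ p : Fin (k + 2), complexBetti.map (F p) (k + 1) (cupPowOne ℂ (ComplexPoints A.X) (k + 1) v) =
      ∑ S : Finset (Fin (k + 1)), (((p : ℕ) : ℂ) ^ S.card) • cupPowOne ℂ (ComplexPoints (A.X ⊗ A.X)) (k + 1)
        (S.piecewise (fun j ↦ complexBetti.map (fst A.X A.X) 1 (v j))
          (fun j ↦ complexBetti.map (snd A.X A.X) 1 (v j))) := by
    intro p
    rw [complexBetti_map_cupPowOne]
    simp_rw [hF1]
    exact cupPowOne_smul_add (k + 1) _ _ _
  simp_rw [hexp, Finset.smul_sum, smul_smul]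
  rw [Finset.sum_comm]
  simp_rw [← Finset.sum_smul]
  have hwS : ∀ S : Finset (Fin (k + 1)), ∑ p : Fin (k + 2), w p * ((p : ℕ) : ℂ) ^ S.card =
      if S.card = 1 then 1 else 0 := by
    intro S
    have hS : S.card < k + 2 := by
      have := S.card_le_univ; simp only [Fintype.card_fin] at this; omega
    exact hw ⟨S.card, hS⟩
  simp_rw [hwS, ite_smul, one_smul, zero_smul]
  rw [Finset.sum_ite, Finset.sum_const_zero, add_zero]
  have hfilter : (Finset.univ.filter fun S : Finset (Fin (k + 1)) ↦ S.card = 1) =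
      (Finset.univ : Finset (Fin (k + 1))).powersetCard 1 := by
    rw [Finset.powersetCard_eq_filter, Finset.powerset_univ]
  rw [hfilter, Finset.powersetCard_one, Finset.sum_map]
  refine Finset.sum_congr rfl fun i _ ↦ ?_
  change cupPowOne ℂ _ (k + 1) (({i} : Finset (Fin (k + 1))).piecewise _ _) = _
  congr 1
  funext j
  by_cases hj : j = i
  · subst hj; simp
  · simp [hj]

/-- `Δ^* (Σ_p w_p (F p)^* y) = (k + 1) · y` on `H^{k+1}(A(ℂ); ℂ)`. [cite: vanGeemen1994HodgeAV, 6.5] -/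
private theorem diag_avg {k : ℕ} {w : Fin (k + 2) → ℂ}
    (hw : ∀ r : Fin (k + 2), ∑ p : Fin (k + 2), w p * ((p : ℕ) : ℂ) ^ (r : ℕ) = if (r : ℕ) = 1 then 1 else 0)
    (F : ℕ → (A.X ⊗ A.X ⟶ A.X))
    (hF1 : ∀ (p : ℕ) (x : complexBetti A.X 1), complexBetti.map (F p) 1 x =
      (p : ℂ) • complexBetti.map (fst A.X A.X) 1 x + complexBetti.map (snd A.X A.X) 1 x)
    (y : complexBetti A.X (k + 1)) :
    complexBetti.map (CartesianMonoidalCategory.lift (𝟙 A.X) (𝟙 A.X)) (k + 1)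
        (∑ p : Fin (k + 2), w p • complexBetti.map (F p) (k + 1) y) = ((k + 1 : ℕ) : ℂ) • y := by
  have hspan := (abelianVarietyCohomologyExteriorH1_holds.hasExteriorCohomologyH1 A).span_range_cupPowOne (k + 1)
  set C : complexBetti A.X (k + 1) →ₗ[ℂ] complexBetti (A.X ⊗ A.X) (k + 1) :=
    ∑ p : Fin (k + 2), w p • (complexBetti.map (F p) (k + 1)).hom with hC
  have hCy : ∀ z : complexBetti A.X (k + 1), C z = ∑ p : Fin (k + 2), w p • complexBetti.map (F p) (k + 1) z := by
    intro z
    rw [hC, LinearMap.coe_sum, Finset.sum_apply]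
    rfl
  have key : (complexBetti.map (CartesianMonoidalCategory.lift (𝟙 A.X) (𝟙 A.X)) (k + 1)).hom ∘ₗ C =
      ((k + 1 : ℕ) : ℂ) • LinearMap.id := by
    refine LinearMap.ext_on_range hspan fun v ↦ ?_
    rw [LinearMap.comp_apply, LinearMap.smul_apply, LinearMap.id_apply, hCy]
    change complexBetti.map (CartesianMonoidalCategory.lift (𝟙 A.X) (𝟙 A.X)) (k + 1)
      (∑ p : Fin (k + 2), w p • complexBetti.map (F p) (k + 1) (cupPowOne ℂ (ComplexPoints A.X) (k + 1) v)) = _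
    rw [avg_cupPowOne hw F hF1, map_sum]
    simp_rw [diag_map_M1]
    rw [Finset.sum_const, Finset.card_univ, Fintype.card_fin, ← Nat.cast_smul_eq_nsmul ℂ]
  have := LinearMap.congr_fun key y
  rw [LinearMap.comp_apply, hCy] at this
  simpa using this

/-- `1 ∈ H⁰(A(ℂ); ℂ)` is a Lefschetz class of `A^{×1} = A` (empty product of divisor classes). [cite: Milne1999LefschetzClasses, §4 p. 657 (D_hom(X)_k)] -/
theorem one_mem_lefschetzPowClasses_zero :
    (singularCohomology.one ℂ (ComplexPoints A.X) : complexBetti (cartesianPow A.X 1) (2 * 0)) ∈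
      lefschetzPowClasses A.dim A.X 0 0 :=
  mem_divisorClassesSpan_of_eq_zero_or_lt A (Or.inl rfl) _

/-- `g₀ 1 = 1` on `H⁰`. [folklore] -/
private theorem kunneth_one_eq (h0 : G 0 = g)
    (hfix : ∀ (a p : ℕ), ∀ x ∈ lefschetzPowClasses A.dim A.X a p, G a (2 * p) x = x) :
    g 0 (singularCohomology.one ℂ (ComplexPoints A.X)) = singularCohomology.one ℂ (ComplexPoints A.X) := by
  have := hfix 0 0 _ (one_mem_lefschetzPowClasses_zero (A := A))
  rw [h0] at this
  exact this

/-- **The exterior action, for a Künneth family fixing the Lefschetz classes** (`0 < dim A`):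
`g_k(v₁ ∪ ⋯ ∪ v_k) = g₁v₁ ∪ ⋯ ∪ g₁v_k` — the averaging argument of `HodgeGroupExterior.kunneth_cupPowOne` with the
homomorphisms `f_p = p·pr₁ + pr₂`, whose graph classes are Lefschetz (Cor. 5.6). [cite: Milne1999LefschetzClasses, Thm. 4.4, Def. 4.3 (p. 659), Cor. 5.6 and Prop. 5.7]
[cite: vanGeemen1994HodgeAV, 6.4–6.5] -/
theorem kunneth_cupPowOne (hA0 : 0 < A.dim) (hG : IsKunnethFamily A.X G) (h0 : G 0 = g) (h1 : G 1 = G1)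
    (hfix : ∀ (a p : ℕ), ∀ x ∈ lefschetzPowClasses A.dim A.X a p, G a (2 * p) x = x) :
    ∀ (k : ℕ) (v : Fin k → complexBetti A.X 1),
      g k (cupPowOne ℂ (ComplexPoints A.X) k v) = cupPowOne ℂ (ComplexPoints A.X) k (fun j ↦ g 1 (v j)) := by
  -- the homomorphisms `f_p = p·pr₁ + pr₂ : A × A → A` on schemes
  let F : ℕ → (A.X ⊗ A.X ⟶ A.X) := fun p ↦ (p • AbelianVariety.fst A A + AbelianVariety.snd A A).hom.hom.hom
  have hF1 : ∀ (p : ℕ) (x : complexBetti A.X 1), complexBetti.map (F p) 1 x =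
      (p : ℂ) • complexBetti.map (fst A.X A.X) 1 x + complexBetti.map (snd A.X A.X) 1 x :=
    fun p x ↦ map_nsmul_fst_add_snd_one A p x
  have hFG : ∀ (p k : ℕ) (y : complexBetti A.X k),
      G1 k (complexBetti.map (F p) k y) = complexBetti.map (F p) k (g k y) := fun p k y ↦
    kunneth_one_apply_map hA0 hG h0 h1 hfix (p • AbelianVariety.fst A A + AbelianVariety.snd A A) (F p) rfl k y
  intro k
  induction k with
  | zero =>
    intro v
    rw [cupPowOne_zero, cupPowOne_zero]
    exact kunneth_one_eq h0 hfix
  | succ k ih =>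
    intro v
    obtain ⟨w, hw⟩ := exists_lagrangeWeights k
    -- `G₁` commutes with the averaging operator, and maps `Σ_i M_i(v)` to `Σ_i M_i(g ∘ v)`
    have hC : ∑ p : Fin (k + 2), w p • complexBetti.map (F p) (k + 1) (g (k + 1) (cupPowOne ℂ (ComplexPoints A.X) (k + 1) v)) =
        ∑ p : Fin (k + 2), w p • complexBetti.map (F p) (k + 1)
          (cupPowOne ℂ (ComplexPoints A.X) (k + 1) (fun j ↦ g 1 (v j))) := by
      have hl : ∑ p : Fin (k + 2), w p • complexBetti.map (F p) (k + 1)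
          (g (k + 1) (cupPowOne ℂ (ComplexPoints A.X) (k + 1) v)) =
          G1 (k + 1) (∑ p : Fin (k + 2), w p • complexBetti.map (F p) (k + 1) (cupPowOne ℂ (ComplexPoints A.X) (k + 1) v)) := by
        rw [map_sum]
        exact Finset.sum_congr rfl fun p _ ↦ by rw [map_smul, hFG]
      rw [hl, avg_cupPowOne hw F hF1, avg_cupPowOne hw F hF1, map_sum]
      exact Finset.sum_congr rfl fun i _ ↦ kunneth_M1 hG h0 h1 k ih v i
    have h2 := congrArg (complexBetti.map (CartesianMonoidalCategory.lift (𝟙 A.X) (𝟙 A.X)) (k + 1)) hC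
    rw [diag_avg hw F hF1, diag_avg hw F hF1] at h2
    exact smul_right_injective _ (Nat.cast_ne_zero.2 (Nat.succ_ne_zero k)) h2

/-- Multiplicativity with a degree-one factor: `g (w ∪ z) = g w ∪ g z`, `w ∈ H¹` (on monomials `z`). [folklore] -/
private theorem kunneth_cupProduct_one (hA0 : 0 < A.dim) (hG : IsKunnethFamily A.X G) (h0 : G 0 = g) (h1 : G 1 = G1)
    (hfix : ∀ (a p : ℕ), ∀ x ∈ lefschetzPowClasses A.dim A.X a p, G a (2 * p) x = x)
    {k' k : ℕ} (h : 1 + k' = k) (w : complexBetti A.X 1) (z : complexBetti A.X k') :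
    g k (cupProduct h w z) = cupProduct h (g 1 w) (g k' z) := by
  obtain rfl : k = k' + 1 := by omega
  have hspan := (abelianVarietyCohomologyExteriorH1_holds.hasExteriorCohomologyH1 A).span_range_cupPowOne k'
  have key : (g (k' + 1) : complexBetti A.X (k' + 1) →ₗ[ℂ] complexBetti A.X (k' + 1)) ∘ₗ cupProduct h w =
      cupProduct h (g 1 w) ∘ₗ (g k' : complexBetti A.X k' →ₗ[ℂ] complexBetti A.X k') := by
    refine LinearMap.ext_on_range hspan fun u ↦ ?_
    simp only [LinearMap.coe_comp, LinearEquiv.coe_coe, Function.comp_apply]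
    rw [kunneth_cupPowOne hA0 hG h0 h1 hfix k' u, cupProduct_cupPowOne, cupProduct_cupPowOne,
      kunneth_cupPowOne hA0 hG h0 h1 hfix (k' + 1)]
    congr 1
    funext j
    refine Fin.cases ?_ (fun j' ↦ ?_) j
    · simp
    · simp
  exact LinearMap.congr_fun key z

/-- **Multiplicativity** for a Künneth family fixing the Lefschetz classes: `g (x ∪ y) = g x ∪ g y` on `H•(A(ℂ); ℂ) = ⋀•H¹`.
[cite: Milne1999LefschetzClasses, Thm. 4.4 and Def. 4.3 (p. 659)] [cite: vanGeemen1994HodgeAV, 6.5] -/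
theorem kunneth_cupProduct (hA0 : 0 < A.dim) (hG : IsKunnethFamily A.X G) (h0 : G 0 = g) (h1 : G 1 = G1)
    (hfix : ∀ (a p : ℕ), ∀ x ∈ lefschetzPowClasses A.dim A.X a p, G a (2 * p) x = x) :
    ∀ (i j k : ℕ) (h : i + j = k) (x : complexBetti A.X i) (y : complexBetti A.X j),
      g k (cupProduct h x y) = cupProduct h (g i x) (g j y) := by
  intro i
  induction i with
  | zero =>
    intro j k h x y
    obtain rfl : k = j := by omega
    have hspan := (abelianVarietyCohomologyExteriorH1_holds.hasExteriorCohomologyH1 A).span_range_cupPowOne 0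
    have hx : x ∈ Submodule.span ℂ (Set.range (cupPowOne ℂ (ComplexPoints A.X) 0)) := by
      rw [hspan]; exact Submodule.mem_top
    have hrange : Set.range (cupPowOne ℂ (ComplexPoints A.X) 0) = {singularCohomology.one ℂ (ComplexPoints A.X)} := by
      ext c
      simp only [Set.mem_range, cupPowOne_zero, Set.mem_singleton_iff]
      exact ⟨fun ⟨_, hc⟩ ↦ hc.symm, fun hc ↦ ⟨fun i ↦ i.elim0, hc.symm⟩⟩
    rw [hrange, Submodule.mem_span_singleton] at hx
    obtain ⟨c, rfl⟩ := hx
    have hone : ∀ z : complexBetti A.X k, cupProduct h (singularCohomology.one ℂ (ComplexPoints A.X)) z = z :=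
      fun z ↦ one_cupProduct z
    rw [LinearMap.map_smul₂, map_smul (g k), map_smul (g 0), kunneth_one_eq h0 hfix, LinearMap.map_smul₂,
      hone, hone]
  | succ i ih =>
    intro j k h x y
    have hspan := (abelianVarietyCohomologyExteriorH1_holds.hasExteriorCohomologyH1 A).span_range_cupPowOne (i + 1)
    have key : (g k : complexBetti A.X k →ₗ[ℂ] complexBetti A.X k) ∘ₗ (cupProduct h).flip y =
        (cupProduct h).flip (g j y) ∘ₗ (g (i + 1) : complexBetti A.X (i + 1) →ₗ[ℂ] complexBetti A.X (i + 1)) := by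
      refine LinearMap.ext_on_range hspan fun u ↦ ?_
      simp only [LinearMap.coe_comp, LinearEquiv.coe_coe, Function.comp_apply, LinearMap.flip_apply]
      rw [cupPowOne_succ, cupProduct_assoc (Nat.add_comm 1 i) rfl h (by omega),
        kunneth_cupProduct_one hA0 hG h0 h1 hfix (by omega), ih j (i + j) rfl,
        ← cupProduct_assoc (Nat.add_comm 1 i) rfl h (by omega),
        ← kunneth_cupProduct_one hA0 hG h0 h1 hfix (Nat.add_comm 1 i)]
    have := LinearMap.congr_fun key x
    simpa using this

end LefschetzGroupExterior

/-! ### §3 Main statements: `ker l(A)` and `L(A)` act through `⋀•` of `H¹`; an element is determined by its `H¹`-component -/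

section Main

open LefschetzGroupExterior

variable {A : AbelianVariety ℂ} {gA gA' : ∀ k : ℕ, complexBetti A.X k ≃ₗ[ℂ] complexBetti A.X k}

/-- An element of `ker l(A)(ℂ)` fixes `H⁰(A(ℂ); ℂ) = ℂ · 1` pointwise. [cite: Milne1999LefschetzClasses, §4 p. 659 (Def. 4.3)] -/
theorem specialLefschetzGroup_apply_zero (hg : gA ∈ specialLefschetzGroup A.dim A.X) (z : complexBetti A.X 0) : gA 0 z = z := by
  obtain ⟨G, hG, h0, hfix⟩ := hg
  have hspan := (abelianVarietyCohomologyExteriorH1_holds.hasExteriorCohomologyH1 A).span_range_cupPowOne 0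
  have hz : z ∈ Submodule.span ℂ (Set.range (cupPowOne ℂ (ComplexPoints A.X) 0)) := by
    rw [hspan]; exact Submodule.mem_top
  have hrange : Set.range (cupPowOne ℂ (ComplexPoints A.X) 0) = {singularCohomology.one ℂ (ComplexPoints A.X)} := by
    ext c
    simp only [Set.mem_range, cupPowOne_zero, Set.mem_singleton_iff]
    exact ⟨fun ⟨_, hc⟩ ↦ hc.symm, fun hc ↦ ⟨fun i ↦ i.elim0, hc.symm⟩⟩
  rw [hrange, Submodule.mem_span_singleton] at hz
  obtain ⟨c, rfl⟩ := hz
  rw [map_smul, kunneth_one_eq h0 hfix]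

/-- **Milne's `ker l(A)(ℂ)` acts on `Hᵏ(A(ℂ); ℂ)` through `⋀ᵏ` of its action on `H¹`**: for `g ∈ specialLefschetzGroup` (the
families of `∏ₖ GL(Hᵏ)` whose Künneth extensions fix the Lefschetz classes of all powers, `Milne1999/LefschetzGroup`),
`g_k(v₁ ∪ ⋯ ∪ v_k) = g₁v₁ ∪ ⋯ ∪ g₁v_k` — Milne's Def. 4.3 puts `L(A) ⊂ GL(V(A)) × 𝔾_m` acting on `H^*(A) = ⋀^*V(A)^∨` through
`V(A) = H₁`; on the tree's family-valued carrier this is a THEOREM (Cor. 5.6 / 5.8: the graphs of the homomorphisms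
`p·pr₁ + pr₂ : A × A → A` and the Künneth components of the diagonal are Lefschetz, so the averaging argument of
`HodgeTheory/HodgeGroupExteriorAction` runs for `ker l`). [cite: Milne1999LefschetzClasses, Def. 4.3, Thm. 4.4 (p. 659), Cor. 5.6, Prop. 5.7, Cor. 5.8 (pp. 663–664)]
[cite: vanGeemen1994HodgeAV, 6.4–6.5] -/
theorem specialLefschetzGroup_apply_cupPowOne (hg : gA ∈ specialLefschetzGroup A.dim A.X) (k : ℕ)
    (v : Fin k → complexBetti A.X 1) :
    gA k (cupPowOne ℂ (ComplexPoints A.X) k v) = cupPowOne ℂ (ComplexPoints A.X) k (fun j ↦ gA 1 (v j)) := by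
  rcases Nat.eq_zero_or_pos A.dim with hA | hA0
  · cases k with
    | zero => exact specialLefschetzGroup_apply_zero hg _
    | succ k =>
      haveI := subsingleton_complexBetti (AbelianVariety.isSmoothProjective_holds (A := A)) (k := k + 1) (by omega)
      exact Subsingleton.elim _ _
  · obtain ⟨G, hG, h0, hfix⟩ := hg
    exact kunneth_cupPowOne hA0 hG h0 rfl hfix k v

/-- **`ker l(A)(ℂ)` acts multiplicatively on `H•(A(ℂ); ℂ)`**: `g(x ∪ y) = g x ∪ g y`.
[cite: Milne1999LefschetzClasses, Def. 4.3 and Thm. 4.4 (p. 659)] [cite: vanGeemen1994HodgeAV, 6.5] -/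
theorem specialLefschetzGroup_map_cupProduct (hg : gA ∈ specialLefschetzGroup A.dim A.X) {i j k : ℕ} (h : i + j = k)
    (x : complexBetti A.X i) (y : complexBetti A.X j) :
    gA k (cupProduct h x y) = cupProduct h (gA i x) (gA j y) := by
  rcases Nat.eq_zero_or_pos A.dim with hA | hA0
  · cases k with
    | zero =>
      obtain rfl : i = 0 := by omega
      obtain rfl : j = 0 := by omega
      rw [specialLefschetzGroup_apply_zero hg, specialLefschetzGroup_apply_zero hg, specialLefschetzGroup_apply_zero hg]
    | succ k =>
      haveI := subsingleton_complexBetti (AbelianVariety.isSmoothProjective_holds (A := A)) (k := k + 1) (by omega)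
      exact Subsingleton.elim _ _
  · obtain ⟨G, hG, h0, hfix⟩ := hg
    exact kunneth_cupProduct hA0 hG h0 rfl hfix i j k h x y

/-- On the exterior power: `g_k ∘ (⋀ᵏH¹ → Hᵏ) = (⋀ᵏH¹ → Hᵏ) ∘ ⋀ᵏ(g₁)` for `g ∈ ker l(A)(ℂ)` (the tree's comparison map
`wedgeToCup`). [cite: Milne1999LefschetzClasses, Def. 4.3 (p. 659)] [cite: LangeBirkenhake1992, Exercise 1.1.6 (7)] -/
theorem specialLefschetzGroup_apply_wedgeToCup (hg : gA ∈ specialLefschetzGroup A.dim A.X) (k : ℕ)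
    (ω : ⋀[ℂ]^k (complexBetti A.X 1)) :
    gA k (wedgeToCup ℂ (ComplexPoints A.X) k ω) =
      wedgeToCup ℂ (ComplexPoints A.X) k (exteriorPower.map k (gA 1 : complexBetti A.X 1 →ₗ[ℂ] complexBetti A.X 1) ω) := by
  have key : (gA k : complexBetti A.X k →ₗ[ℂ] complexBetti A.X k) ∘ₗ wedgeToCup ℂ (ComplexPoints A.X) k =
      wedgeToCup ℂ (ComplexPoints A.X) k ∘ₗ exteriorPower.map k (gA 1 : complexBetti A.X 1 →ₗ[ℂ] complexBetti A.X 1) := by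
    refine LinearMap.ext_on_range (exteriorPower.ιMulti_span ℂ k (complexBetti A.X 1)) fun v ↦ ?_
    rw [LinearMap.comp_apply, LinearMap.comp_apply, LinearEquiv.coe_coe, wedgeToCup_ιMulti,
      exteriorPower.map_apply_ιMulti, wedgeToCup_ιMulti, specialLefschetzGroup_apply_cupPowOne hg]
    rfl
  exact LinearMap.congr_fun key ω

/-- `g_k = ⋀ᵏ(g₁)` read through the tree's `exteriorPullback`: `g_k = exteriorPullback (g₁) k` for `g ∈ ker l(A)(ℂ)`.
[cite: Milne1999LefschetzClasses, Def. 4.3 (p. 659)] -/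
theorem specialLefschetzGroup_apply_eq_exteriorPullback (hg : gA ∈ specialLefschetzGroup A.dim A.X) (k : ℕ)
    (x : complexBetti A.X k) :
    gA k x = exteriorPullback (AbelianVariety.hasExteriorCohomologyH1_complexPoints A)
      (gA 1 : complexBetti A.X 1 →ₗ[ℂ] complexBetti A.X 1) k x := by
  have hΛ := AbelianVariety.hasExteriorCohomologyH1_complexPoints A
  have key : (gA k : complexBetti A.X k →ₗ[ℂ] complexBetti A.X k) =
      exteriorPullback hΛ (gA 1 : complexBetti A.X 1 →ₗ[ℂ] complexBetti A.X 1) k := by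
    refine exteriorPullback_ext hΛ fun v ↦ ?_
    rw [LinearEquiv.coe_coe, specialLefschetzGroup_apply_cupPowOne hg, exteriorPullback_cupPowOne]
    rfl
  exact LinearMap.congr_fun key x

/-- **An element of `ker l(A)(ℂ)` is determined by its degree-one component** (`S(A) ⊂ GL(V(A))`, Milne §1 / Thm. 4.4: the
tree's family-valued `specialLefschetzGroup` is faithfully represented on `H¹`). [cite: Milne1999LefschetzClasses, §1 p. 644 and Thm. 4.4 (p. 659)] -/
theorem specialLefschetzGroup_ext_one (hg : gA ∈ specialLefschetzGroup A.dim A.X) (hg' : gA' ∈ specialLefschetzGroup A.dim A.X)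
    (h1 : gA 1 = gA' 1) : gA = gA' := by
  funext k
  have hspan := (abelianVarietyCohomologyExteriorH1_holds.hasExteriorCohomologyH1 A).span_range_cupPowOne k
  refine LinearEquiv.toLinearMap_injective (LinearMap.ext_on_range hspan fun v ↦ ?_)
  rw [LinearEquiv.coe_coe, LinearEquiv.coe_coe, specialLefschetzGroup_apply_cupPowOne hg,
    specialLefschetzGroup_apply_cupPowOne hg', h1]

/-- The degree-one component of `w(c) · g` is `c · g₁`. [folklore] -/
private theorem weightCocharacter_mul_apply_one (c : ℂˣ) (g : ∀ k : ℕ, complexBetti A.X k ≃ₗ[ℂ] complexBetti A.X k) :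
    (weightCocharacter A.X c * g) 1 = LinearEquiv.smulOfUnit c * g 1 := by
  refine LinearEquiv.ext fun x ↦ ?_
  rw [Pi.mul_apply, LinearEquiv.mul_apply, LinearEquiv.mul_apply, weightCocharacter_apply, pow_one]
  rfl

/-- **An element of `L(A)(ℂ)` is determined by its degree-one component** (`dim A ≥ 1`; `L(A) ⊂ GL(V(A)) × 𝔾_m` with
`l ∘ w = -2`, Milne p. 659): write `g = w(c)·s`, `g' = w(c')·s'` with `s, s' ∈ ker l` (`L = w(𝔾_m)·ker l`); equal
`H¹`-components force `(c/c')·1 ∈ ker l(A)|_{H¹} = S(A)(ℂ)`, hence `(c/c')² = 1`, `w(c/c') ∈ ker l`, and `ker l` is faithful on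
`H¹`. [cite: Milne1999LefschetzClasses, Def. 4.3, Thm. 4.4 and p. 659 (l ∘ w = -2)] -/
theorem lefschetzGroup_ext_one (hA : 1 ≤ A.dim) (hg : gA ∈ lefschetzGroup A.dim A.X) (hg' : gA' ∈ lefschetzGroup A.dim A.X)
    (h1 : gA 1 = gA' 1) : gA = gA' := by
  have hX : IsSmoothProjective A.dim A.X := AbelianVariety.isSmoothProjective_holds (A := A)
  obtain ⟨c, s, hs, rfl⟩ := mem_lefschetzGroup_iff_exists_weightCocharacter_mul.1 hg
  obtain ⟨c', s', hs', rfl⟩ := mem_lefschetzGroup_iff_exists_weightCocharacter_mul.1 hg'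
  -- the scalar `e = c'⁻¹ c` lies in `ker l(A)|_{H¹} = S(A)(ℂ)`, so `e² = 1`
  set e : ℂˣ := c'⁻¹ * c with he
  rw [weightCocharacter_mul_apply_one, weightCocharacter_mul_apply_one] at h1
  have h1' : LinearEquiv.smulOfUnit e * s 1 = s' 1 := by
    have : (LinearEquiv.smulOfUnit c'⁻¹ : complexBetti A.X 1 ≃ₗ[ℂ] complexBetti A.X 1) * (LinearEquiv.smulOfUnit c * s 1) =
        (LinearEquiv.smulOfUnit c'⁻¹ : complexBetti A.X 1 ≃ₗ[ℂ] complexBetti A.X 1) * (LinearEquiv.smulOfUnit c' * s' 1) := by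
      rw [h1]
    rw [← mul_assoc, ← mul_assoc] at this
    have e1 : (LinearEquiv.smulOfUnit c'⁻¹ : complexBetti A.X 1 ≃ₗ[ℂ] complexBetti A.X 1) * LinearEquiv.smulOfUnit c =
        LinearEquiv.smulOfUnit e := by
      refine LinearEquiv.ext fun x ↦ ?_
      simp [LinearEquiv.smulOfUnit, Units.smul_def, smul_smul, he, mul_comm]
    have e2 : (LinearEquiv.smulOfUnit c'⁻¹ : complexBetti A.X 1 ≃ₗ[ℂ] complexBetti A.X 1) * LinearEquiv.smulOfUnit c' = 1 := by
      refine LinearEquiv.ext fun x ↦ ?_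
      simp [LinearEquiv.smulOfUnit, Units.smul_def, smul_smul]
    rwa [e1, e2, one_mul] at this
  have hsc : LinearEquiv.smulOfUnit e ∈ (specialLefschetzGroup A.dim A.X).map
      (Pi.evalMonoidHom (fun k : ℕ ↦ complexBetti A.X k ≃ₗ[ℂ] complexBetti A.X k) 1) := by
    have hmem : LinearEquiv.smulOfUnit e = s' 1 * (s 1)⁻¹ := by rw [← h1', mul_inv_cancel_right]
    rw [hmem]
    exact Subgroup.mul_mem _ ⟨s', hs', rfl⟩ (Subgroup.inv_mem _ ⟨s, hs, rfl⟩)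
  obtain ⟨h, hQ, t, ht, hK⟩ := exists_isRationalClass_and_isKaehlerClass_smul A
  rw [Milne1999_thm44_specialLefschetzGroup_one_eq_unitaryCentralizerGroup_holds A h hQ ⟨t, ht, hK⟩] at hsc
  have he2 : (e : ℂ) ^ 2 = 1 := (smulOfUnit_mem_unitaryCentralizerGroup_iff_of_isKaehlerClass ht.ne' hK hA).1 hsc
  -- `w(e) s ∈ ker l` has the same `H¹`-component as `s'`
  have hwe : weightCocharacter A.X e ∈ specialLefschetzGroup A.dim A.X :=
    (weightCocharacter_mem_specialLefschetzGroup_iff hX hA).2 he2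
  have hus : weightCocharacter A.X e * s = s' :=
    specialLefschetzGroup_ext_one (Subgroup.mul_mem _ hwe hs) hs' (by rw [weightCocharacter_mul_apply_one, h1'])
  rw [← hus, ← mul_assoc, ← weightCocharacter_mul, he, mul_inv_cancel_left]

/-- **`ker l(A)(ℂ) ≅ {g₁ | g ∈ ker l(A)(ℂ)}`, `g ↦ g₁`** (bijectivity of the evaluation at degree one).
[cite: Milne1999LefschetzClasses, §1 p. 644 and Thm. 4.4 (p. 659)] -/
theorem bijective_evalOne_subgroupMap_specialLefschetzGroup (A : AbelianVariety ℂ) :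
    Function.Bijective ((Pi.evalMonoidHom (fun k : ℕ ↦ complexBetti A.X k ≃ₗ[ℂ] complexBetti A.X k) 1).subgroupMap
      (specialLefschetzGroup A.dim A.X)) := by
  refine ⟨?_, MonoidHom.subgroupMap_surjective _ _⟩
  rintro ⟨g, hg⟩ ⟨g', hg'⟩ e
  exact Subtype.ext (specialLefschetzGroup_ext_one hg hg' (congrArg Subtype.val e))

/-- `ker l(A)(ℂ) ≅ {g₁ | g ∈ ker l(A)(ℂ)}` as abstract groups. [cite: Milne1999LefschetzClasses, §1 p. 644 and Thm. 4.4 (p. 659)] -/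
theorem nonempty_specialLefschetzGroup_mulEquiv_map_one (A : AbelianVariety ℂ) :
    Nonempty (specialLefschetzGroup A.dim A.X ≃*
      (specialLefschetzGroup A.dim A.X).map (Pi.evalMonoidHom (fun k : ℕ ↦ complexBetti A.X k ≃ₗ[ℂ] complexBetti A.X k) 1)) :=
  ⟨MulEquiv.ofBijective _ (bijective_evalOne_subgroupMap_specialLefschetzGroup A)⟩

/-- **`L(A)(ℂ) ≅ L(A)(ℂ)|_{H¹}`, `g ↦ g₁`** (`dim A ≥ 1`). [cite: Milne1999LefschetzClasses, Def. 4.3 and Thm. 4.4 (p. 659)] -/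
theorem bijective_evalOne_subgroupMap_lefschetzGroup (hA : 1 ≤ A.dim) :
    Function.Bijective ((Pi.evalMonoidHom (fun k : ℕ ↦ complexBetti A.X k ≃ₗ[ℂ] complexBetti A.X k) 1).subgroupMap
      (lefschetzGroup A.dim A.X)) := by
  refine ⟨?_, MonoidHom.subgroupMap_surjective _ _⟩
  rintro ⟨g, hg⟩ ⟨g', hg'⟩ e
  exact Subtype.ext (lefschetzGroup_ext_one hA hg hg' (congrArg Subtype.val e))

/-- `L(A)(ℂ) ≅ L(A)(ℂ)|_{H¹}` as abstract groups (`dim A ≥ 1`). [cite: Milne1999LefschetzClasses, Def. 4.3 and Thm. 4.4 (p. 659)] -/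
theorem nonempty_lefschetzGroup_mulEquiv_map_one (hA : 1 ≤ A.dim) :
    Nonempty (lefschetzGroup A.dim A.X ≃*
      (lefschetzGroup A.dim A.X).map (Pi.evalMonoidHom (fun k : ℕ ↦ complexBetti A.X k ≃ₗ[ℂ] complexBetti A.X k) 1)) :=
  ⟨MulEquiv.ofBijective _ (bijective_evalOne_subgroupMap_lefschetzGroup hA)⟩

/-! ### §4 Family level ⟺ `H¹` level: `ker l ≤ MT`, Prop. 4.8 (c), and the `H¹`-form of (a) ⟺ (c) -/

/-- **`ker l(A) ≤ MT(A)` (families) iff `{g₁ | g ∈ ker l(A)} ≤ MT(A)|_{H¹}`** (`dim A ≥ 1`): an element of `ker l` whose `H¹`-component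
is that of an element of `MT(A) ≤ L(A)` IS that element (`lefschetzGroup_ext_one`). [cite: Milne1999LefschetzClasses, §4 pp. 659–660 and Prop. 4.8] -/
theorem specialLefschetzGroup_le_mumfordTateGroup_iff_map_le (hA : 1 ≤ A.dim) :
    specialLefschetzGroup A.dim A.X ≤ mumfordTateGroup A.dim A.X ↔
      (specialLefschetzGroup A.dim A.X).map (Pi.evalMonoidHom (fun k : ℕ ↦ complexBetti A.X k ≃ₗ[ℂ] complexBetti A.X k) 1) ≤
        (mumfordTateGroup A.dim A.X).map (Pi.evalMonoidHom (fun k : ℕ ↦ complexBetti A.X k ≃ₗ[ℂ] complexBetti A.X k) 1) := by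
  refine ⟨fun h ↦ Subgroup.map_mono h, fun h s hs ↦ ?_⟩
  obtain ⟨m, hm, e⟩ := h ⟨s, hs, rfl⟩
  have hsm : m = s := lefschetzGroup_ext_one hA ((AbelianVariety.hodgeGroup_le_specialLefschetzGroup A).2 hm)
    (specialLefschetzGroup_le_lefschetzGroup hs) e
  exact hsm ▸ hm

/-- **Milne's Prop. 4.8 (c) at the two levels agree: `Hg′(A) = S(A)` (families) iff `Hg(A)(ℂ)|_{H¹} = {g₁ | g ∈ ker l(A)(ℂ)}`**
(`dim A ≥ 1`). [cite: Milne1999LefschetzClasses, Prop. 4.8 (p. 660) and Thm. 4.4] -/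
theorem hodgeGroup_eq_specialLefschetzGroup_iff_hodgeGroupOne_eq (hA : 1 ≤ A.dim) :
    hodgeGroup A.dim A.X = specialLefschetzGroup A.dim A.X ↔
      VanGeemen1994.hodgeGroupOne A.dim A.X = (specialLefschetzGroup A.dim A.X).map
        (Pi.evalMonoidHom (fun k : ℕ ↦ complexBetti A.X k ≃ₗ[ℂ] complexBetti A.X k) 1) := by
  rw [← specialLefschetzGroup_le_mumfordTateGroup_iff AbelianVariety.isSmoothProjective_holds hA,
    specialLefschetzGroup_le_mumfordTateGroup_iff_map_le hA, map_specialLefschetzGroup_le_map_mumfordTateGroup_iff hA]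

/-- **`Hg(A) = L(A)` (families) iff `MT(A)(ℂ)|_{H¹} = L(A)(ℂ)|_{H¹}`** (`dim A ≥ 1`). [cite: Milne1999LefschetzClasses, Prop. 4.8 (p. 660), §4 p. 659] -/
theorem mumfordTateGroup_eq_lefschetzGroup_iff_map_eq (hA : 1 ≤ A.dim) :
    mumfordTateGroup A.dim A.X = lefschetzGroup A.dim A.X ↔
      (mumfordTateGroup A.dim A.X).map (Pi.evalMonoidHom (fun k : ℕ ↦ complexBetti A.X k ≃ₗ[ℂ] complexBetti A.X k) 1) =
        (lefschetzGroup A.dim A.X).map (Pi.evalMonoidHom (fun k : ℕ ↦ complexBetti A.X k ≃ₗ[ℂ] complexBetti A.X k) 1) := by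
  rw [← specialLefschetzGroup_le_mumfordTateGroup_iff_mumfordTateGroup_eq AbelianVariety.isSmoothProjective_holds,
    specialLefschetzGroup_le_mumfordTateGroup_iff_map_le hA,
    ← map_mumfordTateGroup_sup_map_specialLefschetzGroup_eq_map_lefschetzGroup (A := A), eq_comm, sup_eq_left]

/-- **Milne's Prop. 4.8 (a) ⟺ (c) READ ON `H¹`: `Hg(A)(ℂ)|_{H¹} = S(A)(h)(ℂ)` iff no power of `A` supports an exotic Hodge class**
(`h` a polarization class, `dim A ≥ 1`) — the Hazama–Murty criterion in the `H¹`-form in which Hodge groups are computed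
(`unitaryCentralizerGroup A h` = the centraliser of `End⁰(A)` in the unitary group of the Rosati/polarization form).
[cite: Milne1999LefschetzClasses, Prop. 4.8 (p. 660), Thm. 4.4, Cor. 4.5] [cite: Gordon1999HodgeAVSurvey, Thm. 7.5] -/
theorem hodgeGroupOne_eq_unitaryCentralizerGroup_iff_forall_isDivisorGenerated {h : complexBetti A.X 2}
    (hpol : IsPolarizationClass A.dim A.X h) (hA : 1 ≤ A.dim) :
    VanGeemen1994.hodgeGroupOne A.dim A.X = unitaryCentralizerGroup A h ↔ ∀ a, IsDivisorGenerated (A.powSucc a) := by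
  rw [← hpol.specialLefschetzGroup_map_one_eq hA, ← hodgeGroup_eq_specialLefschetzGroup_iff_hodgeGroupOne_eq hA]
  exact A.hodgeGroup_eq_specialLefschetzGroup_iff_forall_isDivisorGenerated

/-- **`S(A)(h)(ℂ) ≤ MT(A)(ℂ)|_{H¹}` iff no power of `A` supports an exotic Hodge class** (`h` a polarization class, `dim A ≥ 1`).
[cite: Milne1999LefschetzClasses, Prop. 4.8 (p. 660) and §4 pp. 659–660] -/
theorem unitaryCentralizerGroup_le_map_mumfordTateGroup_iff_forall_isDivisorGenerated {h : complexBetti A.X 2}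
    (hpol : IsPolarizationClass A.dim A.X h) (hA : 1 ≤ A.dim) :
    unitaryCentralizerGroup A h ≤ (mumfordTateGroup A.dim A.X).map
        (Pi.evalMonoidHom (fun k : ℕ ↦ complexBetti A.X k ≃ₗ[ℂ] complexBetti A.X k) 1) ↔
      ∀ a, IsDivisorGenerated (A.powSucc a) := by
  rw [unitaryCentralizerGroup_le_map_mumfordTateGroup_iff hpol hA]
  exact hodgeGroupOne_eq_unitaryCentralizerGroup_iff_forall_isDivisorGenerated hpol hA

end Main

end Literature.AlgebraicGeometry.Milne1999

end
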